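import Summits.Ventures.HSemireg.WedgeHankelRecurrenceGaussZerosOffDiagonalExample

/-!
# Venture HSemireg — **STRICT PERRON MONOTONICITY OF THE EXTREME ZEROS IN THE COUPLINGS**: same `a`, `0 < b_j ≤ b'_j` for `1 ≤ j ≤ t` and `b_{j₀} < b'_{j₀}` for SOME `1 ≤ j₀ ≤ t` ⇒ the largest
# zero increases STRICTLY, `x_t < x'_t`, and the smallest decreases strictly, `x'_0 < x_0` (N325 gave `≤`; the Christoffel–Darboux vector at the top zero has ALL entries positive, so the one
# strictly larger cross term is felt)

HONEST FRAMING. Part of the Lean index of the computation cell `pub-hsemireg` (seat p10 gen 45, Sunday typer «UNIFORM-IN-n»).  Real polynomials, finite sums and `Real.sqrt` only; no variety, no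
cohomology theory, no sheaf, no Ext group and no semiregularity map is constructed here; nothing here says that HC / HC_CM / HC_AV holds; no Literature fact (unproved `Prop`) is declared or used.
Custodian versions as in `WedgeHankelSiegelIdeal` (1/3).
SOURCES (cited).  O. Perron, Math. Ann. 64 (1907) 248–263 and G. Frobenius, S.-B. Preuss. Akad. (1912) 456–477 (strict monotonicity of the Perron root of an irreducible non-negative matrix in
each entry); M. E. H. Ismail, *Classical and Quantum Orthogonal Polynomials* (2005) Thm 7.4.1; R. A. Horn, C. R. Johnson, *Matrix Analysis* (2nd ed.) Thm 8.4.5.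
PROOF TYPED HERE (no Perron–Frobenius theory).  N325's comparison `x_t Σ h v*² = Σ μ x P² ≤ Σ μ' x' P'_u² ≤ x'_t Σ h v*²` with the positive Christoffel–Darboux vector `v*` (N322) and the
rescaling `u_i = v*_i √(h_i∕h'_i)`; the termwise inequalities of N325 are summed with `Finset.sum_lt_sum`, the cross term `(j₀ − 1, j₀)` being strict because `v*_{j₀−1} v*_{j₀} > 0` and
`h_{j₀} < h'_{j₀} √(h_{j₀−1}∕h'_{j₀−1}) √(h_{j₀}∕h'_{j₀})` (`= h_{j₀−1} √(b_{j₀} b'_{j₀})`) when `b_{j₀} < b'_{j₀}`.  The bottom zero by the reflection `a ↦ −a` (N325 `recurrence_reflect_spec`).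
DEDUP DISCLOSURE (`rg -n 'strictMono_offdiag|strictAnti_offdiag|cross_gt' Summits/Ventures/HSemireg`, 2026-09-03): N325 `top_zero_mono_offdiag` ∕ `bottom_zero_anti_offdiag` are the weak forms;
the strict forms are new.  The 3 names below: 0 hits tree-wide.

WHAT IS IN THE TREE.  N325 `prod_Ico_one_succ_succ`, `sqrt_rescale_sq`, `sqrt_rescale_cross_ge`, `cd_vector_eval_eq_zero`, `recurrence_reflect_spec`; N301 `sum_mul_node_mul_sq_le_last`; N322
`recurrence_eval_pos_at_top_zero`; N323 `favard_pairing_at_zeros`, `favard_norm_sq_combination`, `favard_x_pairing`, `weighted_sq_combination_expand`; N324 `strictMono_neg_comp_rev`.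
THIS FILE (namespace `Summit.Ventures.HSemireg.Wedge.HankelOuter` continued; CHAINED on N348 (import only); 0 definitions):
* §1114 `sqrt_rescale_cross_gt` (the strict cross-term inequality when `b_{i+1} < b'_{i+1}`), **`top_zero_strictMono_offdiag`** (`x_t < x'_t`), **`bottom_zero_strictAnti_offdiag`** (`x'_0 < x_0`).
CAVEATS.  Positive recurrences sharing `a`, `t ≥ 1` forced by `1 ≤ j₀ ≤ t`; interior zeros obey no sign rule (N348).  Nothing Ext-side.  New names only.
-/

open Module Polynomial
open scoped Matrix Polynomial

namespace Summit.Ventures.HSemireg.Wedge.HankelOuter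

/-! ## §1114. Strict monotonicity of the extreme zeros in the couplings -/

/-- **The strict cross-term inequality: `h_{i+1} < h'_{i+1}·√(h_i∕h'_i)·√(h_{i+1}∕h'_{i+1})` when `b_{i+1} < b'_{i+1}`** (all `b, b' > 0`). [this file, §1114] -/
theorem sqrt_rescale_cross_gt {b b' : ℕ → ℝ} (hb : ∀ j, 0 < b j) (hb' : ∀ j, 0 < b' j) {i : ℕ} (hlt : b (i + 1) < b' (i + 1)) :
    ∏ l ∈ Finset.Ico 1 (i + 1 + 1), b l < (∏ l ∈ Finset.Ico 1 (i + 1 + 1), b' l) *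
      (Real.sqrt ((∏ l ∈ Finset.Ico 1 (i + 1), b l) / ∏ l ∈ Finset.Ico 1 (i + 1), b' l) * Real.sqrt ((∏ l ∈ Finset.Ico 1 (i + 1 + 1), b l) / ∏ l ∈ Finset.Ico 1 (i + 1 + 1), b' l)) := by
  rw [prod_Ico_one_succ_succ b i, prod_Ico_one_succ_succ b' i]
  obtain ⟨A, hA⟩ : ∃ A : ℝ, A = ∏ l ∈ Finset.Ico 1 (i + 1), b l := ⟨_, rfl⟩
  obtain ⟨A', hA'⟩ : ∃ A' : ℝ, A' = ∏ l ∈ Finset.Ico 1 (i + 1), b' l := ⟨_, rfl⟩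
  have hApos : 0 < A := by rw [hA]; exact Finset.prod_pos fun l _ => hb l
  have hA'pos : 0 < A' := by rw [hA']; exact Finset.prod_pos fun l _ => hb' l
  rw [← hA, ← hA']
  have hβ := hb (i + 1)
  have hβ' := hb' (i + 1)
  have hX : A / A' * (A * b (i + 1) / (A' * b' (i + 1))) = A ^ 2 * (b (i + 1) * b' (i + 1)) / (A' * b' (i + 1)) ^ 2 := by
    field_simp
  have hsq : A' * b' (i + 1) * (Real.sqrt (A / A') * Real.sqrt (A * b (i + 1) / (A' * b' (i + 1)))) = Real.sqrt (A ^ 2 * (b (i + 1) * b' (i + 1))) := by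
    rw [← Real.sqrt_mul (div_nonneg hApos.le hA'pos.le), hX, Real.sqrt_div (by positivity), Real.sqrt_sq (by positivity)]
    field_simp
  rw [hsq, show A * b (i + 1) = Real.sqrt ((A * b (i + 1)) ^ 2) from (Real.sqrt_sq (mul_pos hApos hβ).le).symm]
  refine Real.sqrt_lt_sqrt (sq_nonneg _) ?_
  rw [show (A * b (i + 1)) ^ 2 = A ^ 2 * (b (i + 1) * b (i + 1)) by ring]
  exact mul_lt_mul_of_pos_left (mul_lt_mul_of_pos_left hlt hβ) (pow_pos hApos 2)

/-- **THE LARGEST ZERO IS STRICTLY INCREASING IN THE COUPLINGS: same `a`, `0 < b_j ≤ b'_j` (`1 ≤ j ≤ t`), `b_{j₀} < b'_{j₀}` for some `1 ≤ j₀ ≤ t` ⇒ `x_t < x'_t`.**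
[Perron 1907 ∕ Frobenius 1912; Ismail Thm 7.4.1; Horn–Johnson Thm 8.4.5; this file, §1114] -/
theorem top_zero_strictMono_offdiag {q q' : ℕ → ℝ[X]} {a b b' : ℕ → ℝ} (hq0 : q 0 = 1) (hq1 : q 1 = Polynomial.X - C (a 0))
    (hrec : ∀ n, q (n + 2) = (Polynomial.X - C (a (n + 1))) * q (n + 1) - C (b (n + 1)) * q n)
    (hq0' : q' 0 = 1) (hq1' : q' 1 = Polynomial.X - C (a 0)) (hrec' : ∀ n, q' (n + 2) = (Polynomial.X - C (a (n + 1))) * q' (n + 1) - C (b' (n + 1)) * q' n)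
    (hb : ∀ j, 0 < b j) (hb' : ∀ j, 0 < b' j) {t : ℕ} (hbb' : ∀ j, 1 ≤ j → j ≤ t → b j ≤ b' j) {j₀ : ℕ} (hj₀ : 1 ≤ j₀) (hj₀t : j₀ ≤ t) (hlt : b j₀ < b' j₀)
    {x y : Fin (t + 1) → ℝ} (hx : StrictMono x) (hxq : q (t + 1) = ∏ j, (Polynomial.X - C (x j))) (hy : StrictMono y) (hyq : q' (t + 1) = ∏ j, (Polynomial.X - C (y j))) :
    x (Fin.last t) < y (Fin.last t) := by
  obtain ⟨m, rfl⟩ : ∃ m, t = m + 1 := ⟨t - 1, by omega⟩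
  obtain ⟨μ, hμ, hpair⟩ := favard_pairing_at_zeros hq0 hq1 hrec hb hx hxq
  obtain ⟨μ', hμ', hpair'⟩ := favard_pairing_at_zeros hq0' hq1' hrec' hb' hy hyq
  have hxr : ∀ j, (q (m + 2)).eval (x j) = 0 := fun j => by
    rw [hxq, eval_prod]; exact Finset.prod_eq_zero (Finset.mem_univ j) (by rw [eval_sub, eval_X, eval_C, sub_self])
  have hyr : ∀ j, (q' (m + 2)).eval (y j) = 0 := fun j => by
    rw [hyq, eval_prod]; exact Finset.prod_eq_zero (Finset.mem_univ j) (by rw [eval_sub, eval_X, eval_C, sub_self])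
  have hH : ∀ n, 0 < ∏ l ∈ Finset.Ico 1 (n + 1), b l := fun n => Finset.prod_pos fun l _ => hb l
  have hH' : ∀ n, 0 < ∏ l ∈ Finset.Ico 1 (n + 1), b' l := fun n => Finset.prod_pos fun l _ => hb' l
  -- the positive Christoffel–Darboux vector at the top zero, the rescaling, the rescaled vector
  obtain ⟨v, hv⟩ : ∃ v : Fin (m + 2) → ℝ, v = fun (j : Fin (m + 2)) => (∏ l ∈ Finset.Ico ((j : ℕ) + 1) (m + 2), b l) * (q j).eval (x (Fin.last (m + 1))) := ⟨_, rfl⟩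
  have hvpos : ∀ j, 0 < v j := fun j => by
    rw [hv]
    exact mul_pos (Finset.prod_pos fun l _ => hb l) (recurrence_eval_pos_at_top_zero hq0 hq1 hrec hb hx hxq (Nat.lt_succ_iff.1 j.is_lt))
  obtain ⟨s, hs⟩ : ∃ s : Fin (m + 2) → ℝ, s = fun (i : Fin (m + 2)) => Real.sqrt ((∏ l ∈ Finset.Ico 1 ((i : ℕ) + 1), b l) / ∏ l ∈ Finset.Ico 1 ((i : ℕ) + 1), b' l) := ⟨_, rfl⟩
  have hs2 : ∀ i : Fin (m + 2), (∏ l ∈ Finset.Ico 1 ((i : ℕ) + 1), b' l) * s i ^ 2 = ∏ l ∈ Finset.Ico 1 ((i : ℕ) + 1), b l := fun i => by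
    rw [hs]; exact sqrt_rescale_sq (hH i).le (hH' i)
  obtain ⟨u, hu⟩ : ∃ u : Fin (m + 2) → ℝ, u = fun i => v i * s i := ⟨_, rfl⟩
  obtain ⟨P, hP⟩ : ∃ P : ℝ[X], P = ∑ i : Fin (m + 2), C (v i) * q i := ⟨_, rfl⟩
  obtain ⟨P', hP'⟩ : ∃ P' : ℝ[X], P' = ∑ i : Fin (m + 2), C (u i) * q' i := ⟨_, rfl⟩
  have hev : ∀ (w : Fin (m + 2) → ℝ) (r : ℕ → ℝ[X]) (z : ℝ), (∑ i : Fin (m + 2), C (w i) * r i).eval z = ∑ i : Fin (m + 2), w i * (r i).eval z := fun w r z => by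
    rw [eval_finsetSum]; exact Finset.sum_congr rfl fun i _ => by rw [eval_mul, eval_C]
  -- (A) `Σ μ x P² = x_t Σ μ P²`
  have hPx : ∀ k, k ≠ Fin.last (m + 1) → P.eval (x k) = 0 := fun k hk => by rw [hP, hv]; exact cd_vector_eval_eq_zero hq0 hq1 hrec hx hxq hk
  have hFG : ∑ k, μ k * (x k * (P.eval (x k)) ^ 2) = x (Fin.last (m + 1)) * ∑ k, μ k * (P.eval (x k)) ^ 2 := by
    rw [Finset.sum_eq_single (Fin.last (m + 1)) (fun k _ hk => by rw [hPx k hk]; ring) (fun h => absurd (Finset.mem_univ _) h),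
      Finset.sum_eq_single (Fin.last (m + 1)) (fun k _ hk => by rw [hPx k hk]; ring) (fun h => absurd (Finset.mem_univ _) h)]
    ring
  -- (B) Rayleigh bound for the second recurrence
  have hF'le : ∑ k, μ' k * (y k * (P'.eval (y k)) ^ 2) ≤ y (Fin.last (m + 1)) * ∑ k, μ' k * (P'.eval (y k)) ^ 2 :=
    sum_mul_node_mul_sq_le_last hy (fun k => (hμ' k).le) P'
  -- (C) norms
  have hG : ∑ k, μ k * (P.eval (x k)) ^ 2 = ∑ i : Fin (m + 2), (∏ l ∈ Finset.Ico 1 ((i : ℕ) + 1), b l) * v i ^ 2 := by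
    rw [hP]; exact favard_norm_sq_combination (h := fun n => ∏ l ∈ Finset.Ico 1 (n + 1), b l) hpair v
  have hG' : ∑ k, μ' k * (P'.eval (y k)) ^ 2 = ∑ i : Fin (m + 2), (∏ l ∈ Finset.Ico 1 ((i : ℕ) + 1), b l) * v i ^ 2 := by
    rw [hP', favard_norm_sq_combination (h := fun n => ∏ l ∈ Finset.Ico 1 (n + 1), b' l) hpair' u]
    refine Finset.sum_congr rfl fun i _ => ?_
    rw [← hs2 i, hu]
    ring
  have hGpos : 0 < ∑ i : Fin (m + 2), (∏ l ∈ Finset.Ico 1 ((i : ℕ) + 1), b l) * v i ^ 2 :=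
    Finset.sum_pos (fun i _ => mul_pos (hH i) (pow_pos (hvpos i) 2)) Finset.univ_nonempty
  -- (D) termwise comparison of the `x`-forms, one term strict
  have huu : ∀ i j, u i * u j = v i * v j * (s i * s j) := fun i j => by simp only [hu]; ring
  have hterm : ∀ i j : Fin (m + 2),
      v i * v j * ∑ k, μ k * (x k * ((q i).eval (x k) * (q j).eval (x k))) ≤ u i * u j * ∑ k, μ' k * (y k * ((q' i).eval (y k) * (q' j).eval (y k))) ∧
      ((i : ℕ) + 1 = j → b j < b' j → v i * v j * ∑ k, μ k * (x k * ((q i).eval (x k) * (q j).eval (x k))) < u i * u j * ∑ k, μ' k * (y k * ((q' i).eval (y k) * (q' j).eval (y k)))) := by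
    intro i j
    rw [favard_x_pairing hq0 hq1 hrec hxr hpair i j, favard_x_pairing hq0' hq1' hrec' hyr hpair' i j, mul_add, mul_add, mul_add, mul_add]
    have hvv : 0 < v i * v j := mul_pos (hvpos i) (hvpos j)
    -- diagonal terms are equal
    have hdiag : v i * v j * (if (i : ℕ) = j then a i * ∏ l ∈ Finset.Ico 1 ((j : ℕ) + 1), b l else 0) = u i * u j * (if (i : ℕ) = j then a i * ∏ l ∈ Finset.Ico 1 ((j : ℕ) + 1), b' l else 0) := by
      by_cases h2 : (i : ℕ) = j
      · have hij : i = j := Fin.ext h2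
        subst hij
        rw [if_pos rfl, if_pos rfl, huu]
        have : v i * v i * (s i * s i) * (a i * ∏ l ∈ Finset.Ico 1 ((i : ℕ) + 1), b' l) = v i * v i * (a i * ((∏ l ∈ Finset.Ico 1 ((i : ℕ) + 1), b' l) * s i ^ 2)) := by ring
        rw [this, hs2 i]
      · rw [if_neg h2, if_neg h2, mul_zero, mul_zero]
    -- lower cross terms `i = j + 1`
    have hlow : v i * v j * (if (i : ℕ) = j + 1 then ∏ l ∈ Finset.Ico 1 ((i : ℕ) + 1), b l else 0) ≤ u i * u j * (if (i : ℕ) = j + 1 then ∏ l ∈ Finset.Ico 1 ((i : ℕ) + 1), b' l else 0) := by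
      by_cases h3 : (i : ℕ) = j + 1
      · rw [if_pos h3, if_pos h3, huu, mul_assoc (v i * v j) (s i * s j)]
        refine mul_le_mul_of_nonneg_left ?_ hvv.le
        obtain ⟨ii, hii⟩ := i
        dsimp only at h3 ⊢
        subst h3
        have := sqrt_rescale_cross_ge hb hb' (hbb' ((j : ℕ) + 1) (by omega) (by omega))
        simpa only [hs, mul_comm, mul_left_comm, mul_assoc] using this
      · rw [if_neg h3, if_neg h3, mul_zero, mul_zero]
    -- upper cross terms `j = i + 1`, weak and strict
    have hup : v i * v j * (if (i : ℕ) + 1 = j then ∏ l ∈ Finset.Ico 1 ((j : ℕ) + 1), b l else 0) ≤ u i * u j * (if (i : ℕ) + 1 = j then ∏ l ∈ Finset.Ico 1 ((j : ℕ) + 1), b' l else 0) ∧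
        ((i : ℕ) + 1 = j → b j < b' j → v i * v j * (if (i : ℕ) + 1 = j then ∏ l ∈ Finset.Ico 1 ((j : ℕ) + 1), b l else 0) < u i * u j * (if (i : ℕ) + 1 = j then ∏ l ∈ Finset.Ico 1 ((j : ℕ) + 1), b' l else 0)) := by
      by_cases h1 : (i : ℕ) + 1 = j
      · rw [if_pos h1, if_pos h1, huu, mul_assoc (v i * v j) (s i * s j)]
        obtain ⟨jj, hjj⟩ := j
        dsimp only at h1 ⊢
        subst h1
        refine ⟨mul_le_mul_of_nonneg_left ?_ hvv.le, fun _ hbj => mul_lt_mul_of_pos_left ?_ hvv⟩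
        · have := sqrt_rescale_cross_ge hb hb' (hbb' ((i : ℕ) + 1) (by omega) (by omega))
          simpa only [hs, mul_comm, mul_left_comm, mul_assoc] using this
        · have := sqrt_rescale_cross_gt hb hb' hbj
          simpa only [hs, mul_comm, mul_left_comm, mul_assoc] using this
      · rw [if_neg h1, if_neg h1, mul_zero, mul_zero]
        exact ⟨le_rfl, fun h => absurd h h1⟩
    exact ⟨add_le_add (add_le_add hup.1 hdiag.le) hlow, fun h1 hbj => add_lt_add_of_lt_of_le (add_lt_add_of_lt_of_le (hup.2 h1 hbj) hdiag.le) hlow⟩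
  have hFF : ∑ k, μ k * (x k * (P.eval (x k)) ^ 2) < ∑ k, μ' k * (y k * (P'.eval (y k)) ^ 2) := by
    simp_rw [hP, hP', hev]
    rw [weighted_sq_combination_expand μ x (fun (i : Fin (m + 2)) k => (q i).eval (x k)) v,
      weighted_sq_combination_expand μ' y (fun (i : Fin (m + 2)) k => (q' i).eval (y k)) u]
    refine Finset.sum_lt_sum (fun i _ => Finset.sum_le_sum fun j _ => (hterm i j).1)
      ⟨⟨j₀ - 1, by omega⟩, Finset.mem_univ _, Finset.sum_lt_sum (fun j _ => (hterm _ j).1) ⟨⟨j₀, by omega⟩, Finset.mem_univ _, (hterm _ _).2 (by simp; omega) hlt⟩⟩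
  -- the chain `x_t G = F < F' ≤ y_t G`
  rw [hG] at hFG
  rw [hG'] at hF'le
  exact lt_of_mul_lt_mul_right (by rw [← hFG]; exact hFF.trans_le hF'le) hGpos.le

/-- **THE SMALLEST ZERO IS STRICTLY DECREASING IN THE COUPLINGS: same hypotheses ⇒ `x'_0 < x_0`.** [Perron 1907; Ismail Thm 7.4.1; this file, §1114] -/
theorem bottom_zero_strictAnti_offdiag {q q' : ℕ → ℝ[X]} {a b b' : ℕ → ℝ} (hq0 : q 0 = 1) (hq1 : q 1 = Polynomial.X - C (a 0))
    (hrec : ∀ n, q (n + 2) = (Polynomial.X - C (a (n + 1))) * q (n + 1) - C (b (n + 1)) * q n)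
    (hq0' : q' 0 = 1) (hq1' : q' 1 = Polynomial.X - C (a 0)) (hrec' : ∀ n, q' (n + 2) = (Polynomial.X - C (a (n + 1))) * q' (n + 1) - C (b' (n + 1)) * q' n)
    (hb : ∀ j, 0 < b j) (hb' : ∀ j, 0 < b' j) {t : ℕ} (hbb' : ∀ j, 1 ≤ j → j ≤ t → b j ≤ b' j) {j₀ : ℕ} (hj₀ : 1 ≤ j₀) (hj₀t : j₀ ≤ t) (hlt : b j₀ < b' j₀)
    {x y : Fin (t + 1) → ℝ} (hx : StrictMono x) (hxq : q (t + 1) = ∏ j, (Polynomial.X - C (x j))) (hy : StrictMono y) (hyq : q' (t + 1) = ∏ j, (Polynomial.X - C (y j))) :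
    y 0 < x 0 := by
  obtain ⟨h0, h1, h2, h3⟩ := recurrence_reflect_spec hq0 hq1 hrec
  obtain ⟨h0', h1', h2', h3'⟩ := recurrence_reflect_spec hq0' hq1' hrec'
  have h := top_zero_strictMono_offdiag (q := fun n => C ((-1 : ℝ) ^ n) * (q n).comp (C (-1 : ℝ)⁻¹ * Polynomial.X))
    (q' := fun n => C ((-1 : ℝ) ^ n) * (q' n).comp (C (-1 : ℝ)⁻¹ * Polynomial.X)) (a := fun n => -a n)
    h0 h1 h2 h0' h1' h2' hb hb' hbb' hj₀ hj₀t hlt (strictMono_neg_comp_rev hx) (h3 hxq) (strictMono_neg_comp_rev hy) (h3' hyq)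
  simp only [Fin.rev_last] at h
  linarith

end Summit.Ventures.HSemireg.Wedge.HankelOuter
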